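import Summits.HodgeConjecture.CorCM.TwoGroupHalfSubgroup
import HarnessLib

/-!
# A non-central involution which is a square has two conjugates (case A of the order-`32` base, exponent `4`)

COR-CM (cell `pub-hodgecm2`), binder seat b04 (gen 37), count-neutral own lane «Galois-CM-type classification».  KERNEL ONLY:
theorems; no definition, no named fact, no `sorry`.  Pure group theory (A7-JUNCTION gen-37 addendum, the exponent-`4` branch
of lemma SIZE2).  `|G| = 32`, `c` a central involution.

* `conj_eq_mul_of_index_two` — if the centraliser of an involution `v` has index `2` and `c` is the ONLY central involution,
  then `v` is conjugate to `vc` and every conjugate of `v` is `v` or `vc` (`v · xvx⁻¹` is a central involution).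
* `index_centralizer_sq_eq_two` — if `g` has order `4`, `v = g² ≠ c` and `v` is not central, then `C(v)` has index `2`:
  otherwise `C(v) = ⟨g⟩ × ⟨c⟩`, and an element `n` of its normaliser outside it (normaliser growth) conjugates `g` into
  `⟨g⟩ × ⟨c⟩`, whence `n v n⁻¹ = (n g n⁻¹)² = v`, i.e. `n ∈ C(v)`.
* `exists_two_conjugates_of_sq` — the combination used by the case-A driver when `Gal` has exponent `4`.

## References

* [Rotman1995] J. J. Rotman, *An Introduction to the Theory of Groups*, 4th ed., GTM 148, Thm. 4.3 and Ch. 4 Ex. 4.4.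
-/

namespace Summit.HodgeConjecture.CorCM.GaloisModels.CaseA

variable {G : Type*} [Group G] [Finite G]

/-! ## §1 Index-two centralisers -/

omit [Finite G] in
/-- **Index `2` ⟹ conjugates `{v, vc}`.**  `c` the only central involution, `v` an involution whose centraliser has index
`2`: then `x v x⁻¹ = v c` for some `x`, and every conjugate of `v` is `v` or `v c`. [cite: Rotman1995, Ch. 4 Ex. 4.4] -/
theorem conj_eq_mul_of_index_two {c v : G} (huci : ∀ s : G, s * s = 1 → (∀ g : G, g * s = s * g) → s = 1 ∨ s = c)
    (hvv : v * v = 1) (hidx : (Subgroup.centralizer ({v} : Set G)).index = 2) :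
    ∃ x : G, x * v * x⁻¹ = v * c ∧ ∀ g : G, g * v * g⁻¹ = v ∨ g * v * g⁻¹ = v * c := by
  classical
  set C := Subgroup.centralizer ({v} : Set G) with hC
  have hmemC : ∀ g : G, g ∈ C ↔ g * v = v * g := fun g => Subgroup.mem_centralizer_singleton_iff
  haveI hN := Subgroup.normal_of_index_eq_two hidx
  have hvC : v ∈ C := (hmemC v).2 rfl
  have hCtop : C ≠ ⊤ := fun h => by
    rw [← Subgroup.index_eq_one, hidx] at h
    exact absurd h (by norm_num)
  obtain ⟨x, hx⟩ : ∃ x : G, x ∉ C := by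
    by_contra hall
    push Not at hall
    exact hCtop (eq_top_iff.2 fun g _ => hall g)
  set v' := x * v * x⁻¹ with hv'
  have hv'C : v' ∈ C := hN.conj_mem v hvC x
  have hvv' : v' * v = v * v' := (hmemC v').1 hv'C
  have hne : v' ≠ v := fun h => hx ((hmemC x).2 (mul_inv_eq_iff_eq_mul.1 h))
  -- elements of `C` fix `v'` too: `x⁻¹ k x ∈ C`
  have hkv' : ∀ k ∈ C, k * v' = v' * k := by
    intro k hk
    have hk' : x⁻¹ * k * x ∈ C := by
      have := hN.conj_mem k hk x⁻¹
      rwa [inv_inv] at this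
    have h1 : x⁻¹ * k * x * v = v * (x⁻¹ * k * x) := (hmemC _).1 hk'
    calc k * v' = x * (x⁻¹ * k * x * v) * x⁻¹ := by rw [hv']; group
      _ = x * (v * (x⁻¹ * k * x)) * x⁻¹ := by rw [h1]
      _ = v' * k := by rw [hv']; group
  -- conjugation: `C` fixes `v` and `v'`; `x C` swaps them
  have hx2 : x * x ∈ C := Subgroup.mul_self_mem_of_index_two hidx x
  have hxv' : x * v' * x⁻¹ = v := by
    have h1 : x * x * v = v * (x * x) := (hmemC _).1 hx2
    calc x * v' * x⁻¹ = (x * x) * v * (x * x)⁻¹ := by rw [hv']; group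
      _ = v := by rw [h1]; group
  have hconj : ∀ g : G, (g * v * g⁻¹ = v ∧ g * v' * g⁻¹ = v') ∨ (g * v * g⁻¹ = v' ∧ g * v' * g⁻¹ = v) := by
    intro g
    by_cases hg : g ∈ C
    · left
      exact ⟨by rw [(hmemC g).1 hg]; group, by rw [hkv' g hg]; group⟩
    · right
      have hk : x⁻¹ * g ∈ C := by
        rw [Subgroup.mul_mem_iff_of_index_two hidx]
        exact ⟨fun h => absurd (by simpa using h) hx, fun h => absurd h hg⟩
      have h1 : x⁻¹ * g * v = v * (x⁻¹ * g) := (hmemC _).1 hk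
      have h2 : x⁻¹ * g * v' = v' * (x⁻¹ * g) := hkv' _ hk
      constructor
      · calc g * v * g⁻¹ = x * (x⁻¹ * g * v) * g⁻¹ := by group
          _ = x * (v * (x⁻¹ * g)) * g⁻¹ := by rw [h1]
          _ = v' := by rw [hv']; group
      · calc g * v' * g⁻¹ = x * (x⁻¹ * g * v') * g⁻¹ := by group
          _ = x * (v' * (x⁻¹ * g)) * g⁻¹ := by rw [h2]
          _ = x * v' * x⁻¹ := by group
          _ = v := hxv'
  -- `w = v v'` is a central involution `≠ 1`, hence `w = c`
  have hw : v * v' = c := by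
    have hww : v * v' * (v * v') = 1 := by
      calc v * v' * (v * v') = v * (v' * v) * v' := by group
        _ = v * (v * v') * v' := by rw [hvv']
        _ = (v * v) * (x * (v * v) * x⁻¹) := by rw [hv']; group
        _ = 1 := by rw [hvv]; group
    have hwcen : ∀ g : G, g * (v * v') = v * v' * g := by
      intro g
      rcases hconj g with ⟨h1, h2⟩ | ⟨h1, h2⟩
      · calc g * (v * v') = (g * v * g⁻¹) * (g * v' * g⁻¹) * g := by group
          _ = v * v' * g := by rw [h1, h2]
      · calc g * (v * v') = (g * v * g⁻¹) * (g * v' * g⁻¹) * g := by group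
          _ = v' * v * g := by rw [h1, h2]
          _ = v * v' * g := by rw [hvv']
    rcases huci (v * v') hww hwcen with h | h
    · exfalso
      apply hne
      calc v' = v * v * v' := by rw [hvv, one_mul]
        _ = v * (v * v') := by group
        _ = v := by rw [h, mul_one]
    · exact h
  have hv'eq : v' = v * c := by
    calc v' = v * v * v' := by rw [hvv, one_mul]
      _ = v * (v * v') := by group
      _ = v * c := by rw [hw]
  refine ⟨x, hv'eq ▸ rfl, fun g => ?_⟩
  rcases hconj g with ⟨h1, -⟩ | ⟨h1, -⟩
  · exact Or.inl h1
  · exact Or.inr (h1.trans hv'eq)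

/-! ## §2 Squares -/

omit [Finite G] in
/-- The involution of `⟨g⟩` (`orderOf g = 4`) is `g²`: an involution `s ≠ g²` is not a power of `g`. [folklore] -/
theorem not_mem_zpowers_of_involution_four {g s : G} (hg : orderOf g = 4) (hss : s * s = 1) (hs1 : s ≠ 1)
    (hs2 : s ≠ g * g) : s ∉ Subgroup.zpowers g := by
  intro hmem
  rw [Subgroup.mem_zpowers_iff] at hmem
  obtain ⟨k, hk⟩ := hmem
  have h2k : g ^ (2 * k) = 1 := by rw [mul_comm, zpow_mul, hk, zpow_two, hss]
  have hd : (4 : ℤ) ∣ 2 * k := by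
    have := orderOf_dvd_iff_zpow_eq_one.2 h2k
    rw [hg] at this
    exact_mod_cast this
  obtain ⟨q, hq⟩ := hd
  have hk' : k = 2 * q := by omega
  have hg4 : g ^ (4 : ℤ) = 1 := by
    rw [show (4 : ℤ) = ((4 : ℕ) : ℤ) by norm_num, zpow_natCast, ← hg, pow_orderOf_eq_one]
  rcases Int.even_or_odd' q with ⟨r, hr | hr⟩
  · apply hs1
    rw [← hk, hk', hr, show (2 : ℤ) * (2 * r) = 4 * r by ring, zpow_mul, hg4, one_zpow]
  · apply hs2
    rw [← hk, hk', hr, show (2 : ℤ) * (2 * r + 1) = 4 * r + 2 by ring, zpow_add, zpow_mul, hg4, one_zpow, one_mul,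
      zpow_two]

/-- **The centraliser of a non-central square involution has index `2`.**  `|G| = 32`, `c ≠ 1` central with `c² = 1`;
`g` of order `4` with `v = g² ≠ c` and `v` not central.  Then `C(v)` has index `2`. [cite: Rotman1995, Thm. 4.3] -/
theorem index_centralizer_sq_eq_two (hcard : Nat.card G = 32) {c g : G} (hcc : c * c = 1) (hc1 : c ≠ 1)
    (hcen : ∀ h : G, c * h = h * c) (hg : orderOf g = 4) (hvc : g * g ≠ c) (hnc : ∃ y : G, y * (g * g) ≠ g * g * y) :
    (Subgroup.centralizer ({g * g} : Set G)).index = 2 := by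
  classical
  set v := g * g with hv
  set C := Subgroup.centralizer ({v} : Set G) with hC
  have hmemC : ∀ h : G, h ∈ C ↔ h * v = v * h := fun h => Subgroup.mem_centralizer_singleton_iff
  have hg4 : g ^ 4 = 1 := by rw [← hg]; exact pow_orderOf_eq_one g
  have hv1 : v ≠ 1 := fun h => by
    have := orderOf_dvd_of_pow_eq_one (show g ^ 2 = 1 by rw [pow_two, ← hv, h])
    rw [hg] at this
    omega
  have hcg : c ∉ Subgroup.zpowers g := not_mem_zpowers_of_involution_four hg hcc hc1 (Ne.symm hvc)
  -- the injection `(i, j) ↦ gⁱ cʲ` into `C`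
  have hcomm : Commute g c := (hcen g).symm
  have hmem : ∀ p : ZMod 4 × ZMod 2, g ^ p.1.val * c ^ p.2.val ∈ C := fun p => by
    rw [hmemC, hv]
    exact (((Commute.refl g).mul_right (Commute.refl g)).pow_left _ |>.mul_left
      (((hcomm.symm.mul_right hcomm.symm)).pow_left _)).eq
  set f : ZMod 4 × ZMod 2 → C := fun p => ⟨g ^ p.1.val * c ^ p.2.val, hmem p⟩ with hf
  have hc' : ∀ i i' : ℕ, g ^ i * c = g ^ i' → False := by
    intro i i' h
    apply hcg
    have : c = (g ^ i)⁻¹ * g ^ i' := by rw [← h, inv_mul_cancel_left]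
    rw [this]
    exact Subgroup.mul_mem _ (Subgroup.inv_mem _ (Subgroup.pow_mem _ (Subgroup.mem_zpowers g) i))
      (Subgroup.pow_mem _ (Subgroup.mem_zpowers g) i')
  have hinj : Function.Injective f := by
    have hi : ∀ {i i' : ZMod 4}, g ^ i.val = g ^ i'.val → i = i' := by
      intro i i' h
      rw [pow_inj_mod, hg, Nat.mod_eq_of_lt (ZMod.val_lt i), Nat.mod_eq_of_lt (ZMod.val_lt i')] at h
      exact ZMod.val_injective 4 h
    have h2 : ∀ j : ZMod 2, j = 0 ∨ j = 1 := by decide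
    rintro ⟨i, j⟩ ⟨i', j'⟩ h
    simp only [hf, Subtype.mk.injEq] at h
    rcases h2 j with rfl | rfl <;> rcases h2 j' with rfl | rfl
    · simp only [ZMod.val_zero, pow_zero, mul_one] at h
      rw [hi h]
    · simp only [ZMod.val_zero, pow_zero, mul_one, show (1 : ZMod 2).val = 1 from rfl, pow_one] at h
      exact (hc' _ _ h.symm).elim
    · simp only [ZMod.val_zero, pow_zero, mul_one, show (1 : ZMod 2).val = 1 from rfl, pow_one] at h
      exact (hc' _ _ h).elim
    · simp only [show (1 : ZMod 2).val = 1 from rfl, pow_one] at h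
      rw [hi (mul_right_cancel h)]
  -- `|C| ∈ {8, 16}`; we exclude `8`
  have hCtop : C ≠ ⊤ := by
    obtain ⟨y, hy⟩ := hnc
    intro h
    have : y ∈ C := by rw [h]; exact Subgroup.mem_top y
    exact hy ((hmemC y).1 this)
  have hdvd : Nat.card C ∣ 2 ^ 5 := by
    rw [show (2:ℕ) ^ 5 = 32 by norm_num, ← hcard]; exact Subgroup.card_subgroup_dvd_card C
  obtain ⟨k, hk5, hk⟩ := (Nat.dvd_prime_pow Nat.prime_two).1 hdvd
  have h8 : 8 ≤ Nat.card C := by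
    have := Nat.card_le_card_of_injective f hinj
    rwa [Nat.card_prod, Nat.card_zmod, Nat.card_zmod] at this
  have hne32 : Nat.card C ≠ 32 := fun h => hCtop (Subgroup.eq_top_of_card_eq C (by rw [h, hcard]))
  have hne8 : Nat.card C ≠ 8 := by
    intro h8'
    -- then `f` is a bijection: every element of `C` is `gⁱ cʲ`
    have hbij : Function.Bijective f := hinj.bijective_of_nat_card_le (by
      rw [Nat.card_prod, Nat.card_zmod, Nat.card_zmod, h8'])
    -- normaliser growth
    have hncond : NormalizerCondition G := by
      haveI : Fact (Nat.Prime 2) := ⟨Nat.prime_two⟩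
      haveI := (IsPGroup.of_card (p := 2) (n := 5) (by rw [hcard]; norm_num) : IsPGroup 2 G).isNilpotent
      exact Group.normalizerCondition_of_isNilpotent
    obtain ⟨n, hnN, hn⟩ := SetLike.exists_of_lt (hncond C (lt_top_iff_ne_top.2 hCtop))
    have hgC : g ∈ C := (hmemC g).2 (by rw [hv]; group)
    have hngn : n * g * n⁻¹ ∈ C := ((Subgroup.mem_normalizer_iff.1 hnN) g).1 hgC
    obtain ⟨⟨i, j⟩, hij⟩ := hbij.2 ⟨n * g * n⁻¹, hngn⟩
    have hij' : g ^ i.val * c ^ j.val = n * g * n⁻¹ := by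
      have := congrArg Subtype.val hij
      simpa [hf] using this
    -- squares: `(gⁱ cʲ)² = g^{2i}`, `(n g n⁻¹)² = n v n⁻¹`
    have hsq : n * v * n⁻¹ = g ^ (2 * i.val) := by
      calc n * v * n⁻¹ = (n * g * n⁻¹) * (n * g * n⁻¹) := by rw [hv]; group
        _ = (g ^ i.val * c ^ j.val) * (g ^ i.val * c ^ j.val) := by rw [hij']
        _ = g ^ i.val * g ^ i.val * (c ^ j.val * c ^ j.val) := by
            rw [mul_assoc, ← mul_assoc (c ^ j.val), ← (hcomm.pow_pow i.val j.val).eq]; group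
        _ = g ^ (2 * i.val) := by
            rw [← pow_add c, ← two_mul, pow_mul, pow_two c, hcc, one_pow, mul_one, ← pow_add, two_mul]
    apply hn
    rw [hmemC]
    rcases Nat.even_or_odd i.val with ⟨r, hr⟩ | ⟨r, hr⟩
    · -- `n v n⁻¹ = 1`: impossible
      exfalso
      rw [hr, show 2 * (r + r) = 4 * r by ring, pow_mul, hg4, one_pow, mul_inv_eq_one, mul_eq_left] at hsq
      exact hv1 hsq
    · rw [hr, show 2 * (2 * r + 1) = 4 * r + 2 by ring, pow_add, pow_mul, hg4, one_pow, one_mul, pow_two, ← hv,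
        mul_inv_eq_iff_eq_mul] at hsq
      exact hsq
  have hC16 : Nat.card C = 16 := by
    interval_cases k <;> simp_all
  have := C.card_mul_index
  rw [hC16, hcard] at this
  omega

/-- **Two conjugates from a square** (exponent-`4` branch of case A).  `|G| = 32`, `c` the ONLY central involution (`c ≠ 1`,
`c² = 1`), `g` of order `4` with `g² ∉ {1, c}`... then `v = g²` is conjugate to `vc` and all its conjugates lie in `{v, vc}`.
[cite: Rotman1995, Thm. 4.3 and Ch. 4 Ex. 4.4] -/
theorem exists_two_conjugates_of_sq (hcard : Nat.card G = 32) {c g : G} (hcc : c * c = 1) (hc1 : c ≠ 1)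
    (hcen : ∀ h : G, c * h = h * c) (huci : ∀ s : G, s * s = 1 → (∀ h : G, h * s = s * h) → s = 1 ∨ s = c)
    (hg4 : g ^ 4 = 1) (hv1 : g * g ≠ 1) (hvc : g * g ≠ c) :
    ∃ x : G, x * (g * g) * x⁻¹ = g * g * c ∧ ∀ h : G, h * (g * g) * h⁻¹ = g * g ∨ h * (g * g) * h⁻¹ = g * g * c := by
  have hvv : g * g * (g * g) = 1 := by
    rw [show g * g * (g * g) = g ^ 4 by simp only [pow_succ, pow_zero, one_mul, mul_assoc]]
    exact hg4
  have hnc : ∃ y : G, y * (g * g) ≠ g * g * y := by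
    by_contra hall
    push Not at hall
    rcases huci (g * g) hvv hall with h | h
    · exact hv1 h
    · exact hvc h
  have hg : orderOf g = 4 := by
    haveI : Fact (Nat.Prime 2) := ⟨Nat.prime_two⟩
    have h1 : ¬ g ^ 2 ^ 1 = 1 := by rw [pow_one, pow_two]; exact hv1
    have h2 : g ^ 2 ^ (1 + 1) = 1 := by simpa using hg4
    have h := orderOf_eq_prime_pow h1 h2
    simpa using h
  exact conj_eq_mul_of_index_two huci hvv (index_centralizer_sq_eq_two hcard hcc hc1 hcen hg hvc hnc)

end Summit.HodgeConjecture.CorCM.GaloisModels.CaseA
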